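import Literature.Claims.NS.Seo2025
import Summits.NavierStokesRegularity.NavierStokesRegularity.Theorems.SoloRefuteIotti2011
import Literature.Barriers.NavierStokesRegularity.SmallDataGlobalRegularity
import Literature.Analysis.FluidPDE.ClassicalSolutionRescale
import Literature.Analysis.FluidPDE.WholeSpaceGagliardoNirenbergSup
import Literature.Analysis.FluidPDE.NSLerayHopfSereginEnergyProofs
import Literature.Analysis.FluidPDE.NSQuasipotential
import HarnessLib

/-!
# C163 `Seo2025` — refuter-of-record kit: Thm 4.1 (9) is false on the printed class AND on both
charitable faces (rest state excluded; Clay class (4) with global smooth solutions)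

Typed skeleton `Literature.Claims.NS.Seo2025` (p532634 @ 467f9916a898, sha16 89d75ba4f9aea972, typist-5 g6).
`Thm41 ν Cs` (Thm 4.1 (9) p.3 l.23–29, binder `h41` of `claim_of_steps`, the first consumed) asks for
ONE constant `K > 0` below the Seo discriminant `D_NS(u(t)) = ν‖∇u(t)‖²_{H¹} − C_S‖(u·∇)u(t)‖_{L²}`
of every classical solution at every positive time.

* **Rest state (the printed class `u₀ ∈ L²` contains it):** `u ≡ 0`, `p ≡ 0`, `D_NS ≡ 0 < K`
  (`not_Thm41_restState`).
* **Charitable faces (nonzero data; Clay class):** Leray's scaling. For a global smooth solution `u`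
  of the unforced system (Kato's small-data theorem, tree `exists_clayA_smul`, datum `c₀ • swirlU`)
  the rescaled pair `u_c(t,x) = c u(c²t, cx)`, `p_c = c² p(c²t, cx)` is again a global smooth solution,
  with the nonzero compactly supported divergence-free datum `c c₀ swirlU(c x)`, and at time `t = c⁻²`
  its slice is `x ↦ c V(cx)`, `V = u(1)`.  Exact change of variables on `ℝ³`:
  `‖∇(cV(c·))‖²_{L²} = c‖∇V‖²`, `‖∇²(cV(c·))‖²_{L²} = c³‖∇²V‖²`, `‖(cV(c·))·∇(cV(c·))‖_{L²} = c^{3/2}‖V·∇V‖`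
  (as extended reals, so no finiteness is needed: an infinite norm has `toReal = 0` on both sides).
  Hence `D_NS(u_c(c⁻²)) ≤ c · M(V, ν, C_S)` for `0 < c ≤ 1`, which is `< K` for small `c`
  (`not_Thm41_nz`, `not_Thm41_clay`, whence `not_Thm41`, `not_forall_Thm41`).
* Records: `Fig2_Positive` fails at the rest state (`not_Fig2_Positive`), so the typed proof shape
  `Proof41_Composes` is inhabited vacuously (`proof41_composes_vacuous`); given `¬ Thm41`, the inference
  binder `Step_9to10 ν Cs` (ν > 0) is inhabited vacuously (`step_9to10_vacuous`).

WHAT THIS IS NOT: not a claim about NS regularity or blow-up; not a claim about any author beyond the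
typed locator.
-/

set_option linter.dupNamespace false

noncomputable section

namespace Summit.NavierStokesRegularity.NavierStokesRegularity.Theorems.Seo2025

open Real Set Function MeasureTheory
open scoped ENNReal NNReal ContDiff Topology
open Literature.Analysis Literature.Analysis.FluidPDE Literature.Claims.NS.ClayVariants
open Literature.Claims.NS.Seo2025
open Summit.NavierStokesRegularity.NavierStokesRegularity.Theorems.Iotti2011
  (swirlU contDiff_swirlU hasCompactSupport_swirlU isDivFree_swirlU norm_swirlU_half e0)

/-! ## 1. The rest state -/

/-- `D_NS` of the rest state is `0`. [folklore] -/
theorem Dns_zero (ν Cs : ℝ) : Dns ν Cs (0 : E3 → E3) = 0 := by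
  have h1 : fderiv ℝ (0 : E3 → E3) = 0 := by
    funext x; exact fderiv_const_apply (0 : E3)
  have h2 : iteratedFDeriv ℝ 2 (0 : E3 → E3) = 0 := iteratedFDeriv_fun_zero
  simp [Dns, gradH1Sq, advL2, h1, h2]

/-- **(9) as printed fails at the rest state** (`u₀ = 0 ∈ L²`, `u ≡ 0`, `p ≡ 0` on `[0,1) × ℝ³`,
`t = 1/2`: `K ≤ D_NS(0) = 0`). [cite: Seo2025, Thm 4.1 (9) p.3 l.23–29] -/
theorem not_Thm41_restState {ν : ℝ} (hν : 0 < ν) (Cs : ℝ) : ¬ Thm41 ν Cs := by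
  intro h
  obtain ⟨K, hK, hall⟩ := h hν
  have hdiv : IsWeaklyDivFree (0 : E3 → E3) := fun θ _ => by simp
  have key := hall 0 MemLp.zero hdiv 1 0 0 (isClassicalNSSolutionOn_zero (E := E3) (Ico 0 1) ν) rfl
    (1 / 2) ⟨by norm_num, by norm_num⟩
  rw [Pi.zero_apply, Dns_zero] at key
  linarith

/-- The posit «`D_NS(t) > 0` (Figure 2)» fails at the rest state, for every `ν, C_S`.
[cite: Seo2025, proof of Thm 4.1 p.3 l.34; Figure 2 p.3] -/
theorem not_Fig2_Positive (ν Cs : ℝ) : ¬ Fig2_Positive ν Cs := by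
  intro h
  have key := h 1 0 0 (isClassicalNSSolutionOn_zero (E := E3) (Ico 0 1) ν) (1 / 2) ⟨by norm_num, by norm_num⟩
  rw [Pi.zero_apply, Dns_zero] at key
  exact lt_irrefl _ key

/-- Hence the typed SHAPE of the printed proof is inhabited vacuously (its second premise is false).
[cite: Seo2025, proof of Thm 4.1 p.3 l.33 – p.4 l.2] -/
theorem proof41_composes_vacuous (ν Cs : ℝ) : Proof41_Composes ν Cs :=
  fun _ hfig => absurd hfig (not_Fig2_Positive ν Cs)

/-! ## 2. Leray scaling of the discriminant: `x ↦ c V(c x)` -/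

variable {V : E3 → E3} {c : ℝ}

/-- `D(cV(c·))(x) = c² DV(cx)`. [folklore] -/
theorem fderiv_nsRescaleData (hV : Differentiable ℝ V) (x : E3) :
    fderiv ℝ (nsRescaleData c V) x = (c * c) • fderiv ℝ V (c • x) := by
  have hd : DifferentiableAt ℝ (fun y => V (c • y)) x :=
    (hV (c • x)).comp x (differentiableAt_id.const_smul c)
  rw [show nsRescaleData c V = fun y => c • (fun z => V (c • z)) y from rfl,
    fderiv_fun_const_smul hd, fderiv_comp_smul, smul_smul]

/-- Change of variables on `ℝ³`: `∫ G(cx) dx = c⁻³ ∫ G`. [folklore] -/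
theorem lintegral_comp_smul_E3 (G : E3 → ℝ≥0∞) (hc : 0 < c) :
    ∫⁻ x, G (c • x) = ENNReal.ofReal (c ^ 3)⁻¹ * ∫⁻ y, G y := by
  have h := lintegral_comp_space_affine hc (0 : E3) G
  simp only [zero_add, finrank_euclideanSpace_fin] at h
  exact h

/-- `‖∇(cV(c·))‖²_{L²} = c ‖∇V‖²_{L²}` (extended reals). [folklore] -/
theorem lintegral_fderiv_nsRescaleData (hV : Differentiable ℝ V) (hc : 0 < c) :
    ∫⁻ x, ‖fderiv ℝ (nsRescaleData c V) x‖ₑ ^ 2 = ENNReal.ofReal c * ∫⁻ y, ‖fderiv ℝ V y‖ₑ ^ 2 := by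
  have h1 : ∀ x, ‖fderiv ℝ (nsRescaleData c V) x‖ₑ ^ 2 =
      ENNReal.ofReal ((c * c) ^ 2) * (fun y => ‖fderiv ℝ V y‖ₑ ^ 2) (c • x) := by
    intro x
    rw [fderiv_nsRescaleData hV x, enorm_smul, mul_pow, Real.enorm_eq_ofReal (by positivity),
      ENNReal.ofReal_pow (by positivity)]
  calc ∫⁻ x, ‖fderiv ℝ (nsRescaleData c V) x‖ₑ ^ 2
      = ∫⁻ x, ENNReal.ofReal ((c * c) ^ 2) * (fun y => ‖fderiv ℝ V y‖ₑ ^ 2) (c • x) :=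
        lintegral_congr fun x => h1 x
    _ = ENNReal.ofReal ((c * c) ^ 2) * (ENNReal.ofReal (c ^ 3)⁻¹ * ∫⁻ y, ‖fderiv ℝ V y‖ₑ ^ 2) := by
        rw [lintegral_const_mul' _ _ ENNReal.ofReal_ne_top,
          lintegral_comp_smul_E3 (fun y => ‖fderiv ℝ V y‖ₑ ^ 2) hc]
    _ = ENNReal.ofReal c * ∫⁻ y, ‖fderiv ℝ V y‖ₑ ^ 2 := by
        rw [← mul_assoc, ← ENNReal.ofReal_mul (by positivity)]
        congr 2
        field_simp

/-- `‖∇²(cV(c·))(x)‖ = c³ ‖∇²V(cx)‖`. [folklore] -/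
theorem enorm_iteratedFDeriv_two_nsRescaleData (hV : ContDiff ℝ 2 V) (hc : 0 < c) (x : E3) :
    ‖iteratedFDeriv ℝ 2 (nsRescaleData c V) x‖ₑ =
      ENNReal.ofReal (c ^ 3) * ‖iteratedFDeriv ℝ 2 V (c • x)‖ₑ := by
  have hin : ContDiff ℝ 2 (fun y => V (c • y)) := hV.comp (contDiff_const_smul c)
  have e1 : iteratedFDeriv ℝ 2 (nsRescaleData c V) x = c • iteratedFDeriv ℝ 2 (fun y => V (c • y)) x := by
    rw [show nsRescaleData c V = c • fun y => V (c • y) from rfl,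
      iteratedFDeriv_const_smul_apply hin.contDiffAt]
  have e2 : ‖iteratedFDeriv ℝ 2 (fun y => V (c • y)) x‖ = c ^ 2 * ‖iteratedFDeriv ℝ 2 V (c • x)‖ := by
    rw [norm_iteratedFDeriv_comp_smul hV c x le_rfl, abs_of_pos hc]
  rw [e1, enorm_smul, ← ofReal_norm (iteratedFDeriv ℝ 2 (fun y => V (c • y)) x), e2,
    Real.enorm_eq_ofReal hc.le, ENNReal.ofReal_mul (by positivity), ofReal_norm, ← mul_assoc,
    ← ENNReal.ofReal_mul hc.le]
  congr 2
  ring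

/-- `‖∇²(cV(c·))‖²_{L²} = c³ ‖∇²V‖²_{L²}` (extended reals). [folklore] -/
theorem lintegral_iteratedFDeriv_two_nsRescaleData (hV : ContDiff ℝ 2 V) (hc : 0 < c) :
    ∫⁻ x, ‖iteratedFDeriv ℝ 2 (nsRescaleData c V) x‖ₑ ^ 2 =
      ENNReal.ofReal (c ^ 3) * ∫⁻ y, ‖iteratedFDeriv ℝ 2 V y‖ₑ ^ 2 := by
  have h1 : ∀ x, ‖iteratedFDeriv ℝ 2 (nsRescaleData c V) x‖ₑ ^ 2 =
      ENNReal.ofReal ((c ^ 3) ^ 2) * (fun y => ‖iteratedFDeriv ℝ 2 V y‖ₑ ^ 2) (c • x) := by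
    intro x
    rw [enorm_iteratedFDeriv_two_nsRescaleData hV hc x, mul_pow, ← ENNReal.ofReal_pow (by positivity)]
  calc ∫⁻ x, ‖iteratedFDeriv ℝ 2 (nsRescaleData c V) x‖ₑ ^ 2
      = ∫⁻ x, ENNReal.ofReal ((c ^ 3) ^ 2) * (fun y => ‖iteratedFDeriv ℝ 2 V y‖ₑ ^ 2) (c • x) :=
        lintegral_congr fun x => h1 x
    _ = ENNReal.ofReal ((c ^ 3) ^ 2) *
          (ENNReal.ofReal (c ^ 3)⁻¹ * ∫⁻ y, ‖iteratedFDeriv ℝ 2 V y‖ₑ ^ 2) := by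
        rw [lintegral_const_mul' _ _ ENNReal.ofReal_ne_top,
          lintegral_comp_smul_E3 (fun y => ‖iteratedFDeriv ℝ 2 V y‖ₑ ^ 2) hc]
    _ = ENNReal.ofReal (c ^ 3) * ∫⁻ y, ‖iteratedFDeriv ℝ 2 V y‖ₑ ^ 2 := by
        rw [← mul_assoc, ← ENNReal.ofReal_mul (by positivity)]
        congr 2
        field_simp

/-- `‖(cV(c·))·∇(cV(c·))‖²_{L²} = c³ ‖V·∇V‖²_{L²}` (extended reals). [folklore] -/
theorem lintegral_adv_nsRescaleData (hV : Differentiable ℝ V) (hc : 0 < c) :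
    ∫⁻ x, ‖fderiv ℝ (nsRescaleData c V) x (nsRescaleData c V x)‖ₑ ^ 2 =
      ENNReal.ofReal (c ^ 3) * ∫⁻ y, ‖fderiv ℝ V y (V y)‖ₑ ^ 2 := by
  have h1 : ∀ x, ‖fderiv ℝ (nsRescaleData c V) x (nsRescaleData c V x)‖ₑ ^ 2 =
      ENNReal.ofReal ((c * c * c) ^ 2) * (fun y => ‖fderiv ℝ V y (V y)‖ₑ ^ 2) (c • x) := by
    intro x
    rw [fderiv_nsRescaleData hV x, nsRescaleData_apply, smul_apply,
      ContinuousLinearMap.map_smul, smul_smul, enorm_smul, mul_pow,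
      Real.enorm_eq_ofReal (by positivity), ENNReal.ofReal_pow (by positivity)]
  calc ∫⁻ x, ‖fderiv ℝ (nsRescaleData c V) x (nsRescaleData c V x)‖ₑ ^ 2
      = ∫⁻ x, ENNReal.ofReal ((c * c * c) ^ 2) * (fun y => ‖fderiv ℝ V y (V y)‖ₑ ^ 2) (c • x) :=
        lintegral_congr fun x => h1 x
    _ = ENNReal.ofReal ((c * c * c) ^ 2) *
          (ENNReal.ofReal (c ^ 3)⁻¹ * ∫⁻ y, ‖fderiv ℝ V y (V y)‖ₑ ^ 2) := by
        rw [lintegral_const_mul' _ _ ENNReal.ofReal_ne_top,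
          lintegral_comp_smul_E3 (fun y => ‖fderiv ℝ V y (V y)‖ₑ ^ 2) hc]
    _ = ENNReal.ofReal (c ^ 3) * ∫⁻ y, ‖fderiv ℝ V y (V y)‖ₑ ^ 2 := by
        rw [← mul_assoc, ← ENNReal.ofReal_mul (by positivity)]
        congr 2
        field_simp

/-- **Scaling bound**: for `0 < c ≤ 1`, `D_NS(cV(c·)) ≤ c · M(V)` with
`M = ν(‖∇V‖² + ‖∇²V‖²) + |C_S| ‖V·∇V‖` (real parts; an infinite norm contributes `0` on the left).
[folklore] -/
theorem Dns_nsRescaleData_le {ν Cs : ℝ} (hν : 0 ≤ ν) (hV : ContDiff ℝ 2 V) (hc : 0 < c)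
    (hc1 : c ≤ 1) :
    Dns ν Cs (nsRescaleData c V) ≤
      c * (ν * ((∫⁻ y, ‖fderiv ℝ V y‖ₑ ^ 2).toReal + (∫⁻ y, ‖iteratedFDeriv ℝ 2 V y‖ₑ ^ 2).toReal) +
        |Cs| * ((∫⁻ y, ‖fderiv ℝ V y (V y)‖ₑ ^ 2) ^ (1 / 2 : ℝ)).toReal) := by
  have hd : Differentiable ℝ V := hV.differentiable (by norm_num)
  have hI₂ : 0 ≤ (∫⁻ y, ‖iteratedFDeriv ℝ 2 V y‖ₑ ^ 2).toReal := ENNReal.toReal_nonneg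
  have hb : 0 ≤ ((∫⁻ y, ‖fderiv ℝ V y (V y)‖ₑ ^ 2) ^ (1 / 2 : ℝ)).toReal := ENNReal.toReal_nonneg
  -- the `H¹` part
  have hG : (gradH1Sq (nsRescaleData c V)).toReal ≤
      c * (∫⁻ y, ‖fderiv ℝ V y‖ₑ ^ 2).toReal + c * (∫⁻ y, ‖iteratedFDeriv ℝ 2 V y‖ₑ ^ 2).toReal := by
    unfold gradH1Sq
    rw [lintegral_fderiv_nsRescaleData hd hc, lintegral_iteratedFDeriv_two_nsRescaleData hV hc]
    refine ENNReal.toReal_add_le.trans ?_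
    rw [ENNReal.toReal_mul, ENNReal.toReal_mul, ENNReal.toReal_ofReal hc.le,
      ENNReal.toReal_ofReal (by positivity)]
    have hc2 : c * c ≤ 1 := by nlinarith
    have h3 : c ^ 3 ≤ c := by nlinarith [mul_le_mul_of_nonneg_left hc2 hc.le]
    nlinarith [mul_le_mul_of_nonneg_right h3 hI₂]
  -- the advection part
  have hA : (advL2 (nsRescaleData c V)).toReal =
      (c ^ 3) ^ (1 / 2 : ℝ) * ((∫⁻ y, ‖fderiv ℝ V y (V y)‖ₑ ^ 2) ^ (1 / 2 : ℝ)).toReal := by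
    unfold advL2
    rw [lintegral_adv_nsRescaleData hd hc, ENNReal.mul_rpow_of_nonneg _ _ (by norm_num),
      ENNReal.toReal_mul, ← ENNReal.toReal_rpow, ENNReal.toReal_ofReal (by positivity)]
  have h0 : 0 ≤ (c ^ 3) ^ (1 / 2 : ℝ) := by positivity
  have hpow : (c ^ 3) ^ (1 / 2 : ℝ) ≤ c := by
    have hsq : ((c ^ 3) ^ (1 / 2 : ℝ)) ^ 2 = c ^ 3 := by
      rw [← Real.rpow_natCast, ← Real.rpow_mul (by positivity)]
      norm_num
    have hc3 : c ^ 3 ≤ c ^ 2 := by nlinarith [mul_le_mul_of_nonneg_left hc1 (sq_nonneg c)]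
    exact (pow_le_pow_iff_left₀ h0 hc.le two_ne_zero).1 (by rw [hsq]; exact hc3)
  have t1 : ν * (gradH1Sq (nsRescaleData c V)).toReal ≤
      ν * (c * (∫⁻ y, ‖fderiv ℝ V y‖ₑ ^ 2).toReal + c * (∫⁻ y, ‖iteratedFDeriv ℝ 2 V y‖ₑ ^ 2).toReal) :=
    mul_le_mul_of_nonneg_left hG hν
  have t2 : -(Cs * (advL2 (nsRescaleData c V)).toReal) ≤
      |Cs| * (c * ((∫⁻ y, ‖fderiv ℝ V y (V y)‖ₑ ^ 2) ^ (1 / 2 : ℝ)).toReal) := by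
    rw [hA]
    have s0 := neg_le_abs Cs
    have hyb : 0 ≤ (c ^ 3) ^ (1 / 2 : ℝ) * ((∫⁻ y, ‖fderiv ℝ V y (V y)‖ₑ ^ 2) ^ (1 / 2 : ℝ)).toReal :=
      mul_nonneg h0 hb
    have s2 : |Cs| * ((c ^ 3) ^ (1 / 2 : ℝ) * ((∫⁻ y, ‖fderiv ℝ V y (V y)‖ₑ ^ 2) ^ (1 / 2 : ℝ)).toReal) ≤
        |Cs| * (c * ((∫⁻ y, ‖fderiv ℝ V y (V y)‖ₑ ^ 2) ^ (1 / 2 : ℝ)).toReal) :=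
      mul_le_mul_of_nonneg_left (mul_le_mul_of_nonneg_right hpow hb) (abs_nonneg Cs)
    nlinarith
  unfold Dns
  linarith

/-- **Small scales kill any positive floor**: for every `K > 0` some `c ∈ (0,1]` has
`D_NS(cV(c·)) < K`. [folklore] -/
theorem exists_Dns_nsRescaleData_lt {ν Cs : ℝ} (hν : 0 ≤ ν) (hV : ContDiff ℝ 2 V) {K : ℝ}
    (hK : 0 < K) : ∃ c : ℝ, 0 < c ∧ c ≤ 1 ∧ Dns ν Cs (nsRescaleData c V) < K := by
  set M : ℝ := ν * ((∫⁻ y, ‖fderiv ℝ V y‖ₑ ^ 2).toReal + (∫⁻ y, ‖iteratedFDeriv ℝ 2 V y‖ₑ ^ 2).toReal) +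
    |Cs| * ((∫⁻ y, ‖fderiv ℝ V y (V y)‖ₑ ^ 2) ^ (1 / 2 : ℝ)).toReal with hM_def
  have hM : 0 ≤ M := by positivity
  have hcpos : 0 < min 1 (K / (2 * (M + 1))) := lt_min one_pos (by positivity)
  refine ⟨min 1 (K / (2 * (M + 1))), hcpos, min_le_left _ _, ?_⟩
  have hle := Dns_nsRescaleData_le (Cs := Cs) hν hV hcpos (min_le_left _ _)
  rw [← hM_def] at hle
  have h2 : min 1 (K / (2 * (M + 1))) * M ≤ K / (2 * (M + 1)) * M :=
    mul_le_mul_of_nonneg_right (min_le_right _ _) hM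
  have h3 : K / (2 * (M + 1)) * M < K := by
    rw [div_mul_eq_mul_div, div_lt_iff₀ (by positivity)]
    nlinarith
  linarith

/-! ## 3. The rescaled Kato family and the two charitable faces -/

/-- Divergence-freeness is preserved by `x ↦ c W(c x)`. [folklore] -/
theorem isDivFree_nsRescaleData {W : E3 → E3} (hW : Differentiable ℝ W) (hdiv : NSWave0.IsDivFree W)
    (c : ℝ) : NSWave0.IsDivFree (nsRescaleData c W) := by
  intro x
  have h0 := hdiv (c • x)
  simp only [NSWave0.divergence] at h0 ⊢
  rw [fderiv_nsRescaleData hW x, ContinuousLinearMap.toLinearMap_smul, map_smul, h0, smul_zero]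

/-- **The family**: for every `K > 0` a nonzero smooth compactly supported divergence-free datum with a
global classical solution of the unforced system whose discriminant at some positive time is `< K`
(Kato's global solution for `c₀ • swirlU`, Leray-rescaled). [cite: Kato1984, Thm. 4] -/
theorem exists_solution_Dns_lt {ν : ℝ} (hν : 0 < ν) (Cs : ℝ) {K : ℝ} (hK : 0 < K) :
    ∃ (u₀ : E3 → E3) (u : ℝ → E3 → E3) (p : ℝ → E3 → ℝ) (t : ℝ),
      ContDiff ℝ ∞ u₀ ∧ NSWave0.IsDivFree u₀ ∧ HasCompactSupport u₀ ∧ u₀ ≠ 0 ∧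
        IsClassicalNSSolutionOn (Ici 0) ν 0 u p ∧ u 0 = u₀ ∧ 0 < t ∧ Dns ν Cs (u t) < K := by
  -- Kato's global smooth solution for the small datum `c₀ • swirlU`
  have hdivU : NSWave0.IsDivFree swirlU := fun x => isDivFree_swirlU x
  obtain ⟨c₀, hc₀, hsol⟩ := Literature.Barriers.NavierStokesRegularity.exists_clayA_smul hν
    contDiff_swirlU hdivU
    (HasRapidSpatialDecay.of_hasCompactSupport contDiff_swirlU hasCompactSupport_swirlU)
  obtain ⟨u, p, hsu, hsp, hns, -⟩ := hsol c₀ (abs_of_pos hc₀).le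
  have hcl : IsClassicalNSSolutionOn (Ici 0) ν 0 u p :=
    (isNavierStokesSolution_and_smooth_iff.1 ⟨hns, hsu, hsp⟩).1
  have hu0 : u 0 = c₀ • swirlU := hns.initial
  -- the slice at time `1` and a small scale `c`
  have hV : ContDiff ℝ 2 (u 1) :=
    (hcl.contDiff_velocity (by simp)).of_le (WithTop.coe_le_coe.mpr le_top)
  obtain ⟨c, hc, -, hlt⟩ := exists_Dns_nsRescaleData_lt (Cs := Cs) hν.le hV hK
  -- the rescaled solution `u_c(t,x) = c u(c²t, cx)`, `p_c = c² p(c²t, cx)` is global and classical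
  have hresc := IsClassicalNSSolutionOn.nsRescale_holds hcl hc
  have hpre : ((fun t : ℝ => c ^ 2 * t) ⁻¹' Ici (0 : ℝ)) = Ici 0 := by
    ext t
    simp only [mem_preimage, mem_Ici]
    constructor
    · intro h
      exact le_of_mul_le_mul_left (by rw [mul_zero]; exact h) (by positivity : (0 : ℝ) < c ^ 2)
    · intro h
      positivity
  rw [hpre, nsRescaleForce_zero] at hresc
  -- the test point for non-vanishing of the rescaled datum
  have hx : c • (c⁻¹ • ((1 / 2 : ℝ) • e0)) = (1 / 2 : ℝ) • e0 := by
    rw [smul_smul, mul_inv_cancel₀ hc.ne', one_smul]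
  refine ⟨nsRescaleData c (c₀ • swirlU), FluidPDE.nsRescale c u, nsRescalePressure c p, (c ^ 2)⁻¹,
    ?_, ?_, ?_, ?_, hresc, by rw [nsRescale_zero_time, hu0], by positivity, ?_⟩
  · exact ((contDiff_swirlU.const_smul c₀).comp (contDiff_const_smul c)).const_smul c
  · have hdivW : NSWave0.IsDivFree (c₀ • swirlU) := hu0 ▸ hns.divFree 0 le_rfl
    exact isDivFree_nsRescaleData (W := c₀ • swirlU)
      ((contDiff_swirlU.const_smul c₀).differentiable (by simp)) hdivW c
  · exact ((hasCompactSupport_swirlU.smul_left (f := fun _ : E3 => c₀)).comp_smul hc.ne').smul_left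
      (f := fun _ : E3 => c)
  · intro hD
    have h1 : nsRescaleData c (c₀ • swirlU) (c⁻¹ • ((1 / 2 : ℝ) • e0)) =
        c • (c₀ • swirlU ((1 / 2 : ℝ) • e0)) := by
      rw [nsRescaleData_apply, hx]; rfl
    rw [hD, Pi.zero_apply] at h1
    have h2 := congr_arg norm h1
    rw [norm_zero, norm_smul, norm_smul, norm_swirlU_half, Real.norm_eq_abs, Real.norm_eq_abs,
      abs_of_pos hc, abs_of_pos hc₀] at h2
    nlinarith
  · have hslice : FluidPDE.nsRescale c u (c ^ 2)⁻¹ = nsRescaleData c (u 1) := by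
      funext x
      simp [nsRescale_apply, nsRescaleData_apply, mul_inv_cancel₀ (pow_ne_zero 2 hc.ne')]
    rw [hslice]
    exact hlt

/-- **Charitable face 2 is false** (Clay class (4), nonzero data, the paper's own global smooth
solutions, `t > 0`). [cite: Seo2025, Thm 4.1 (9) p.3 l.23–29; (10) p.4] -/
theorem not_Thm41_clay {ν : ℝ} (hν : 0 < ν) (Cs : ℝ) : ¬ Thm41_clay ν Cs := by
  intro h
  obtain ⟨K, hK, hall⟩ := h hν
  obtain ⟨u₀, u, p, t, hsm, hdiv, hcs, hne, hcl, h0, ht, hlt⟩ := exists_solution_Dns_lt hν Cs hK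
  obtain ⟨hns, hsu, hsp⟩ := isNavierStokesSolution_and_smooth_iff.2 ⟨hcl, h0⟩
  have := hall u₀ hsm hdiv (HasRapidSpatialDecay.of_hasCompactSupport hsm hcs) hne u p hsu hsp hns t ht
  linarith

/-- **Charitable face 1 is false** (rest state excluded: the datum is not a.e. zero).
[cite: Seo2025, Thm 4.1 (9) p.3 l.23–29] -/
theorem not_Thm41_nz {ν : ℝ} (hν : 0 < ν) (Cs : ℝ) : ¬ Thm41_nz ν Cs := by
  intro h
  obtain ⟨K, hK, hall⟩ := h hν
  obtain ⟨u₀, u, p, t, hsm, hdiv, hcs, hne, hcl, h0, ht, hlt⟩ := exists_solution_Dns_lt hν Cs hK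
  obtain ⟨h2, hwd⟩ :=
    memLp_and_weaklyDivFree_of_clayDatum hsm hdiv (HasRapidSpatialDecay.of_hasCompactSupport hsm hcs)
  have hae : ¬ (u₀ =ᵐ[volume] 0) := fun hae =>
    hne ((Continuous.ae_eq_iff_eq volume hsm.continuous continuous_zero).1 hae)
  have hslab : IsClassicalNSSolutionOn (Ico 0 (t + 1)) ν 0 u p :=
    hcl.mono Ico_subset_Ici_self (uniqueDiffOn_Ico 0 (t + 1))
  have := hall u₀ h2 hwd hae (t + 1) u p hslab h0 t ⟨ht, by linarith⟩
  linarith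

/-- **Thm 4.1 (9), AS PRINTED, is false at every viscosity `ν > 0` and every value of the unspecified
`C_Sobolev`** — via the charitable face (so not only because of the rest state).
[cite: Seo2025, Thm 4.1 (9) p.3 l.23–29] -/
theorem not_Thm41 {ν : ℝ} (hν : 0 < ν) (Cs : ℝ) : ¬ Thm41 ν Cs :=
  fun h => not_Thm41_nz hν Cs (thm41_nz_of h)

/-- The binder `h41 : ∀ ν, Thm41 ν Cs` of `claim_of_steps` is uninhabited, for every `Cs`.
[cite: Seo2025, Thm 4.1 (9) p.3 l.23–29; §5 p.4 l.8–9] -/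
theorem not_forall_Thm41 (Cs : ℝ) : ¬ ∀ ν, Thm41 ν Cs := fun h => not_Thm41 one_pos Cs (h 1)

/-- Record: given `¬ Thm41`, the inference binder (9) ⇒ (10) is inhabited vacuously at every `ν > 0`
(it carries no content once its premise is false). [cite: Seo2025, p.3 l.34 – p.4 l.4] -/
theorem step_9to10_vacuous {ν : ℝ} (hν : 0 < ν) (Cs : ℝ) : Step_9to10 ν Cs :=
  fun h => absurd h (not_Thm41 hν Cs)

end Summit.NavierStokesRegularity.NavierStokesRegularity.Theorems.Seo2025

end

-- WHAT THIS IS NOT: not a claim about NS regularity or blow-up; not a claim about any author beyond the typed locator.
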